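import Mathlib
import HarnessLib
import Summits.Ventures.LatticeQCDFlow.Scoring.DoeblinPowerTwoChainAgreement

/-!
# The two-chain A-versus-B agreement test is CALIBRATED: under equal target means the probability
# of `|z_n| ≤ z` tends to `(gaussianReal 0 1)[−z, z]` — e.g. `≈ 0.683` for the cell's `1σ_comb` rule

HONEST FRAMING: exact (Metropolis-corrected) sampling algorithms for lattice gauge theory;
figures of merit are autocorrelation/cost numbers at stated couplings and volumes; no
continuum-physics claim.

Venture `LatticeQCDFlow` (cell pub-lqcd), topic `Scoring`; FANOUT row 8 (`s0-cpn-nemc`, GEN-22).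
NEW WORK of the cell, not a published result; no definition is introduced; nothing is cited as a
fact.  `Scoring/DoeblinPowerTwoChainAgreement.doeblinPower_twoChain_agreement_clt` gives the
asymptotic standard normality of the z-statistic
`z_n = (f̄_A,n − f̄_B,mₙ)/√(σ̂²_A,n/n + σ̂²_B,mₙ/mₙ)` of two INDEPENDENT Markov-chain runs with
batch-means error bars under Doeblin powers, from any initial laws, when `π_A f_A = π_B f_B`.  This
file reads off the calibration of the acceptance test "A vs B within `z σ_comb`": the probability of
`|z_n| ≤ z` tends to `(gaussianReal 0 1)[−z, z]` (portmanteau on `[−z, z]`, a continuity set of the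
Gaussian law).  Printed counterparts NAMED ONLY: the two-sample z-test (folklore), nothing cited.

## Content

* **`doeblinPower_twoChain_agreement_coverage`** — `z > 0`:
  `(P^A_{μ_A} ⊗ P^B_{μ_B}) {|z_n| ≤ z} → (gaussianReal 0 1)[−z, z]`.

NOT CLAIMED: the power under `π_A f_A ≠ π_B f_B`; dependent arms; any number of ours.
-/

noncomputable section

namespace Summit.Ventures.LatticeQCDFlow.Scoring

open MeasureTheory ProbabilityTheory Filter Finset Preorder
open scoped ENNReal Topology

section TwoChains

variable {ΩA : Type*} [MeasurableSpace ΩA] {κA : Kernel ΩA ΩA} [IsMarkovKernel κA]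
  {νA : Measure ΩA} [IsProbabilityMeasure νA] {εA : ℝ≥0∞} {mA : ℕ}
variable {ΩB : Type*} [MeasurableSpace ΩB] {κB : Kernel ΩB ΩB} [IsMarkovKernel κB]
  {νB : Measure ΩB} [IsProbabilityMeasure νB] {εB : ℝ≥0∞} {mB : ℕ}

/-- **THE TWO-CHAIN AGREEMENT TEST IS CALIBRATED.**  Under the hypotheses of
`doeblinPower_twoChain_agreement_clt` (two independent runs under Doeblin powers, equal target
means, positive asymptotic variances, any `mₙ → ∞`, any initial laws), for every `z > 0`:
the probability of `|z_n| ≤ z` tends to `(gaussianReal 0 1)[−z, z]`. -/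
theorem doeblinPower_twoChain_agreement_coverage
    {πA : Measure ΩA} [IsProbabilityMeasure πA] (hπA : Kernel.Invariant κA πA)
    (hminA : ∀ z, εA • νA ≤ Exactness.nHit κA mA z) (hεA0 : 0 < εA) (hεA1 : εA ≤ 1) (hmA : 0 < mA)
    {fA : ΩA → ℝ} (hfA : Measurable fA) {CA : ℝ} (hCA : ∀ x, |fA x| ≤ CA)
    (hσA : 0 < ((∫ y, (fA y - ∫ z, fA z ∂πA) ^ 2 ∂πA)
            + 2 * ∑' k, ∫ y, (fA y - ∫ z, fA z ∂πA)
              * (kop κA)^[k + 1] (fun y => fA y - ∫ z, fA z ∂πA) y ∂πA))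
    (μA : Measure ΩA) [IsProbabilityMeasure μA] {aA bA : ℕ → ℕ} (haA : Tendsto aA atTop atTop)
    (hbA : Tendsto bA atTop atTop)
    [IsProbabilityMeasure (Kernel.trajMeasure (X := fun _ : ℕ => ΩA) μA
          (fun n : ℕ => κA.comap
            (fun h : (i : ↥(Finset.Iic n)) → ΩA => h ⟨n, Finset.mem_Iic.2 le_rfl⟩)
            (measurable_pi_apply _)))]
    {πB : Measure ΩB} [IsProbabilityMeasure πB] (hπB : Kernel.Invariant κB πB)
    (hminB : ∀ z, εB • νB ≤ Exactness.nHit κB mB z) (hεB0 : 0 < εB) (hεB1 : εB ≤ 1) (hmB : 0 < mB)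
    {fB : ΩB → ℝ} (hfB : Measurable fB) {CB : ℝ} (hCB : ∀ x, |fB x| ≤ CB)
    (hσB : 0 < ((∫ y, (fB y - ∫ z, fB z ∂πB) ^ 2 ∂πB)
            + 2 * ∑' k, ∫ y, (fB y - ∫ z, fB z ∂πB)
              * (kop κB)^[k + 1] (fun y => fB y - ∫ z, fB z ∂πB) y ∂πB))
    (μB : Measure ΩB) [IsProbabilityMeasure μB] {aB bB : ℕ → ℕ} (haB : Tendsto aB atTop atTop)
    (hbB : Tendsto bB atTop atTop)
    [IsProbabilityMeasure (Kernel.trajMeasure (X := fun _ : ℕ => ΩB) μB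
          (fun n : ℕ => κB.comap
            (fun h : (i : ↥(Finset.Iic n)) → ΩB => h ⟨n, Finset.mem_Iic.2 le_rfl⟩)
            (measurable_pi_apply _)))]
    (hmean : ∫ z, fA z ∂πA = ∫ z, fB z ∂πB) {m : ℕ → ℕ} (hm : Tendsto m atTop atTop)
    {z : ℝ} (hz : 0 < z) :
    Tendsto (fun n : ℕ => (((Kernel.trajMeasure (X := fun _ : ℕ => ΩA) μA
          (fun n : ℕ => κA.comap
            (fun h : (i : ↥(Finset.Iic n)) → ΩA => h ⟨n, Finset.mem_Iic.2 le_rfl⟩)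
            (measurable_pi_apply _)))).prod
        (Kernel.trajMeasure (X := fun _ : ℕ => ΩB) μB
          (fun n : ℕ => κB.comap
            (fun h : (i : ↥(Finset.Iic n)) → ΩB => h ⟨n, Finset.mem_Iic.2 le_rfl⟩)
            (measurable_pi_apply _)))).real
      {ω | |((∑ t ∈ Finset.range n, fA (ω.1 t)) / n
            - (∑ t ∈ Finset.range (m n), fB (ω.2 t)) / (m n))
          / Real.sqrt ((((bA n * aA n : ℕ) : ℝ) * replicaSEsq (fun j (x : ℕ → ΩA) =>
              (∑ i ∈ Finset.range (bA n), fA (x (bA n * j + i))) / (bA n)) (aA n) ω.1) / n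
            + (((bB (m n) * aB (m n) : ℕ) : ℝ) * replicaSEsq (fun j (x : ℕ → ΩB) =>
              (∑ i ∈ Finset.range (bB (m n)), fB (x (bB (m n) * j + i)))
              / (bB (m n))) (aB (m n)) ω.2) / (m n))| ≤ z})
      atTop (𝓝 ((gaussianReal 0 1).real (Set.Icc (-z) z))) := by
  have hY : HasLaw (fun a : ℝ => a) (gaussianReal 0 1) (gaussianReal 0 1) :=
    ⟨aemeasurable_id', Measure.map_id'⟩
  have hclt := doeblinPower_twoChain_agreement_clt hπA hminA hεA0 hεA1 hmA hfA hCA hσA μA haA hbA hπB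
    hminB hεB0 hεB1 hmB hfB hCB hσB μB haB hbB hmean hm hY
  have hE : ((gaussianReal 0 1).map (fun a : ℝ => a)) (frontier (Set.Icc (-z) z)) = 0 := by
    rw [Measure.map_id', frontier_Icc (by linarith)]
    haveI := nullSingletonClass_gaussianReal (μ := 0) one_ne_zero
    exact (Set.toFinite _).measure_zero _
  have key := ProbabilityMeasure.tendsto_measure_of_null_frontier_of_tendsto' hclt.tendsto hE
  have key' := (ENNReal.tendsto_toReal (measure_ne_top _ (Set.Icc (-z) z))).comp key
  simp only [ProbabilityMeasure.coe_mk, Function.comp_def, Measure.map_id'] at key'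
  simp only [measureReal_def]
  refine (tendsto_congr fun n => ?_).1 key'
  rw [Measure.map_apply_of_aemeasurable (hclt.forall_aemeasurable n) measurableSet_Icc]
  congr 2
  ext ω
  simp only [Set.mem_preimage, Set.mem_Icc, Set.mem_setOf_eq, abs_le]

end TwoChains

end Summit.Ventures.LatticeQCDFlow.Scoring

end
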